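import Mathlib
import Summits.Ventures.HodgeRepro.Tier4.Line4.LevelPhaseAtP
import Summits.Ventures.HodgeRepro.Tier4.Line4.LevelFibreCompact

/-!
# Tier4/Line4/LevelPhaseAtPProper — PHASE-AT-P with the fibre-compactness binders discharged by PROPER and ZDOMAIN-EX (iv)

Blind re-derivation cell `pub-hodge-repro`, Tier 4 «prove the step» (README §9–§10), seat t4-L4-p1 (prover, LINE L4,
gen 5; plan-4 g7's S15912 (2), second half).  Tree path `lean/Summits/Ventures/HodgeRepro/Tier4/Line4/LevelPhaseAtPProper.lean`.
Mathlib-level; no literature.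

WHAT IS PROVED.  `exists_level_pPhase_close` (LevelPhaseAtP) takes a compact `C ⊆ T_f × T′_f` and a level `n₁` with the
`DZ_f`-cut level fibres of `γ₀` inside `C` from `n₁` on.  `LevelFibreCompact` produces that triple from PROPER
(`HasProperFinOrbit W γ₀`) and ZDOMAIN-EX (iv) (`hDZc`).  Composing:
* **`exists_level_pPhase_close_of_hasProperFinOrbit`** — for `S ⊆ placesAbove p` (`hS`), a linearly regular `γ₀` with PROPER,
  unimodular continuous `χ`, continuous `χ′`, and a domain `DZ_f` with ZDOMAIN-EX (iv): for every `ε > 0` the `S`-part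
  phase is `ε`-close to `1` on the `DZ_f`-cut level fibres of `γ₀` from some level on — PHASE-AT-P with NO fibre binder;
* `exists_level_pPhase_close_of_isLinRegular` — the same with PROPER discharged by C-L4-PROPER (`hdet`, `hg`, `hreg`).

Nothing here says anything about the status of the Hodge conjecture for CM abelian varieties, which is NOT proved
(HC_CM is NOT proved by anyone in this repository).
-/

set_option autoImplicit false

noncomputable section

namespace Summit.Ventures.HodgeRepro.Tier4.Line4

open Summit.Ventures.HodgeRepro.Tier4.Common Summit.Ventures.HodgeRepro.Tier4.Line1 NumberField IsDedekindDomain Topology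
open scoped Pointwise

section PhaseAtPProper

variable {k : Type} [Field k] [NumberField k] (W : PlaneData k) [MeasurableSpace (GA W)] (R : RTFData W)
  (S : Set (HeightOneSpectrum (𝓞 k)))

/-- **PHASE-AT-P without the fibre binders**: under PROPER and ZDOMAIN-EX (iv) for `DZ_f`, the `S`-part phase is
uniformly `ε`-close to `1` on the `DZ_f`-cut level fibres of `γ₀` from some level on. -/
theorem exists_level_pPhase_close_of_hasProperFinOrbit {p : ℕ} (hp : p ≠ 0) (hS : ∀ v, v ∈ S → natSize k v p < 1)
    {γ₀ : rationalPoints W} (hlin : IsLinRegular W γ₀) (hprop : HasProperFinOrbit W (γ₀ : GA W))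
    (hc : Continuous R.chi) (hu : ∀ a, ‖R.chi a‖ = 1) (hc' : Continuous R.chi')
    (DZf : Set (torusFin W))
    (hDZc : ∀ C : Set (torusFin W), IsCompact C → IsCompact (closure (DZf ∩ (C * (ZfIn W : Set (torusFin W))))))
    {ε : ℝ} (hε : 0 < ε) :
    ∃ N₀ : ℕ, ∀ N ≥ N₀, ∀ q ∈ suppSet W (γ₀ : GA W) (p ^ N) (γ₀ : GA W), q.1 ∈ DZf →
      ‖pPhase W R S q - 1‖ < ε := by
  obtain ⟨C, hC, hsub⟩ := exists_compact_suppSet_cut_subset W (γ₀ : GA W) hprop DZf hDZc hp 0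
  exact exists_level_pPhase_close W R S hp hS hlin hc hu hc' DZf C hC 0 hsub hε

/-- PHASE-AT-P without the fibre binders, PROPER discharged by C-L4-PROPER (`hdet`, `hg`, `hreg`). -/
theorem exists_level_pPhase_close_of_isLinRegular {p : ℕ} (hp : p ≠ 0) (hS : ∀ v, v ∈ S → natSize k v p < 1)
    (hdet : W.B.det ≠ 0) (hg : Line1.IsGenuineRow W) {γ₀ : rationalPoints W} (hlin : IsLinRegular W γ₀)
    (hc : Continuous R.chi) (hu : ∀ a, ‖R.chi a‖ = 1) (hc' : Continuous R.chi')
    (DZf : Set (torusFin W))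
    (hDZc : ∀ C : Set (torusFin W), IsCompact C → IsCompact (closure (DZf ∩ (C * (ZfIn W : Set (torusFin W))))))
    {ε : ℝ} (hε : 0 < ε) :
    ∃ N₀ : ℕ, ∀ N ≥ N₀, ∀ q ∈ suppSet W (γ₀ : GA W) (p ^ N) (γ₀ : GA W), q.1 ∈ DZf →
      ‖pPhase W R S q - 1‖ < ε :=
  exists_level_pPhase_close_of_hasProperFinOrbit W R S hp hS hlin
    (hasProperFinOrbit_of_isLinRegular W hdet hg γ₀ hlin) hc hu hc' DZf hDZc hε

end PhaseAtPProper

end Summit.Ventures.HodgeRepro.Tier4.Line4
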